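import Summits.RiemannHypothesis.RiemannHypothesis.Theorems.JensenPolynomialsSkeletonXiMoments
import Literature.Analysis.SpecialFunctions.LaguerreDerivative

/-!
# Route `JensenPolynomials` — rung J-P (P1⁺): the K-TABLE ADAPTER — the blueprint's ratio hypothesis as an inequality between
# Laguerre values at the interlacing zeros (the input format of LEMMA L1)

**RH-FREE, ξ-free** (arbitrary real `γ`, shift `n`, `b = n + ½`, `c = bκ_n > 0`). The blueprint `skeletonSignTest_of_tables`
(`JensenPolynomialsSkeletonExpansion`) asks, for each order `3 ≤ m ≤ d`, for a constant `K_m` with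
`|A^{d−m}_{s_n}(e)| ≤ K_m·|A^{d}_{s_n}(e)|` at every critical point `e` of the skeleton. By LEMMA R (`JensenPolynomialsSkeletonRatios`)
the critical points are `e = −θ_n − c/τ`, `τ` a zero of `L_{d−1}^{(n−½)}`, and `A^k_{s_n}(e) = (e+θ_n)^k (k!/(b)_k) L_k^{(n−½)}(τ)`; at such `τ`
the three-term recurrence gives `d·L_d(τ) = −(b+d−2)·L_{d−2}(τ)` (tree `laguerre_eval_of_eval_pred_eq_zero`, Szegő (5.1.10)). Hence
(`kTable_of_laguerre_bound`): **the `K_m`-clause holds as soon as, at every zero `τ` of `L_{d−1}^{(n−½)}`,**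

  `((d−m)!/(b)_{d−m}) · |τ|^m · |L_{d−m}^{(n−½)}(τ)| ≤ K_m · c^m · (d!/(b)_d) · ((b+d−2)/d) · |L_{d−2}^{(n−½)}(τ)|`,

which is exactly the shape delivered by the tree's LEMMA L1 `Literature.Analysis.SpecialFunctions.laguerre_interlacingRatio_abs_le`
(`(b+d−2−k)_{k+2}|L_{d−2−k}(τ)| ≤ (b+d−2)(b+d−1)(d(b+d−2))^{k/2} M_k |L_{d−2}(τ)|`, `k = m − 2`) together with an upper bound for `|τ|`
(Ismail–Li's bracket for the zeros — L1's oscillatory-window hypothesis; not in the tree). So the ratio side of a kernel proof of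
`TheoremAlphaCertFlat` is reduced to: L1 + a zero bracket + arithmetic of the majorant `M_k`.

WHAT THIS IS NOT: no `K_m` is computed here, L1 is not invoked, no cell of the test is proved; nothing here bears on the truth of RH.
-/

noncomputable section
-- D-0017: `Summit.RiemannHypothesis.RiemannHypothesis.…` duplicates the namespace BY DESIGN (single-problem summit).
set_option linter.dupNamespace false

namespace Summit.RiemannHypothesis.RiemannHypothesis.Theorems.JensenPolynomials

open Literature.NumberTheory.LFunctions Polynomial Finset
open Literature.Analysis.SpecialFunctions (laguerre laguerre_eval_of_eval_pred_eq_zero)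
open scoped BigOperators Nat

/-- At a zero `τ` of `L_{d−1}^{(n−½)}` (`d ≥ 2`): `|L_d(τ)| = ((b+d−2)/d)·|L_{d−2}(τ)|`, `b = n + ½`. -/
theorem abs_laguerre_eval_at_zero (n : ℕ) {d : ℕ} (hd : 2 ≤ d) {τ : ℝ}
    (hτ : (laguerre ((n : ℝ) - 1 / 2) (d - 1)).eval τ = 0) :
    |(laguerre ((n : ℝ) - 1 / 2) d).eval τ| =
      ((n : ℝ) + 1 / 2 + d - 2) / d * |(laguerre ((n : ℝ) - 1 / 2) (d - 2)).eval τ| := by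
  have h := laguerre_eval_of_eval_pred_eq_zero ((n : ℝ) - 1 / 2) hd hτ
  have hd0 : (0 : ℝ) < d := by exact_mod_cast (by omega : 0 < d)
  have hd2 : (2 : ℝ) ≤ d := by exact_mod_cast hd
  have hpos : (0 : ℝ) ≤ (n : ℝ) + 1 / 2 + d - 2 := by
    have : (0 : ℝ) ≤ n := Nat.cast_nonneg n
    linarith
  have h' : (laguerre ((n : ℝ) - 1 / 2) d).eval τ =
      -(((n : ℝ) + 1 / 2 + d - 2) / d) * (laguerre ((n : ℝ) - 1 / 2) (d - 2)).eval τ := by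
    rw [show -(((n : ℝ) + 1 / 2 + d - 2) / d) * (laguerre ((n : ℝ) - 1 / 2) (d - 2)).eval τ =
      (-((d : ℝ) - 1 + ((n : ℝ) - 1 / 2)) * (laguerre ((n : ℝ) - 1 / 2) (d - 2)).eval τ) / d by ring,
      eq_div_iff hd0.ne', mul_comm]
    exact h
  rw [h', abs_mul, abs_neg, abs_of_nonneg (div_nonneg hpos hd0.le)]

/-- **K-TABLE ADAPTER (RH-FREE, ξ-free).** Let `κ_n > 0`, `2 ≤ d`, `m ≤ d`, `b = n + ½`, `c = bκ_n`. If at every zero `τ` of `L_{d−1}^{(n−½)}`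
`((d−m)!/(b)_{d−m})·|τ|^m·|L_{d−m}^{(n−½)}(τ)| ≤ K·(c^m·(d!/(b)_d)·((b+d−2)/d))·|L_{d−2}^{(n−½)}(τ)|`, then the order-`m` ratio clause of the
blueprint holds: `|A^{d−m}_{s_n}(e)| ≤ K·|A^{d}_{s_n}(e)|` at every critical point `e` of the skeleton `A^d_{s_n}`. -/
theorem kTable_of_laguerre_bound (γ : ℕ → ℝ) (n d m : ℕ) (hd : 2 ≤ d) (hm : m ≤ d) (hκ : 0 < skelKappa γ n) (K : ℝ)
    (hL : ∀ τ : ℝ, (laguerre ((n : ℝ) - 1 / 2) (d - 1)).eval τ = 0 →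
      (((d - m) ! : ℕ) : ℝ) / (ascPochhammer ℝ (d - m)).eval ((n : ℝ) + 1 / 2) * |τ| ^ m *
          |(laguerre ((n : ℝ) - 1 / 2) (d - m)).eval τ| ≤
        K * ((((n : ℝ) + 1 / 2) * skelKappa γ n) ^ m * ((d ! : ℝ) / (ascPochhammer ℝ d).eval ((n : ℝ) + 1 / 2)) *
          (((n : ℝ) + 1 / 2 + d - 2) / d)) * |(laguerre ((n : ℝ) - 1 / 2) (d - 2)).eval τ|) :
    ∀ e : ℝ, (derivative (appellPoly (skeletonSeq γ n) d)).eval e = 0 →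
      |(appellPoly (skeletonSeq γ n) (d - m)).eval e| ≤ K * |(appellPoly (skeletonSeq γ n) d).eval e| := by
  intro e he
  have hb : (0 : ℝ) < (n : ℝ) + 1 / 2 := by positivity
  have hc : 0 < ((n : ℝ) + 1 / 2) * skelKappa γ n := mul_pos hb hκ
  obtain ⟨hne, hroot⟩ := (derivative_appellPoly_skeletonSeq_eval_eq_zero_iff γ n (by omega) hκ e).mp he
  have hU : 0 < |e + skelTheta γ n| := abs_pos.mpr hne
  -- the Laguerre data at `τ = −c/(e+θ)`
  have hLτ := hL _ hroot
  have habsτ : |(-(((n : ℝ) + 1 / 2) * skelKappa γ n) / (e + skelTheta γ n))| =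
      ((n : ℝ) + 1 / 2) * skelKappa γ n / |e + skelTheta γ n| := by
    rw [abs_div, abs_neg, abs_of_pos hc]
  rw [habsτ, div_pow] at hLτ
  have hLd := abs_laguerre_eval_at_zero n hd hroot
  -- positive constants
  have hA : 0 < (((d - m) ! : ℕ) : ℝ) / (ascPochhammer ℝ (d - m)).eval ((n : ℝ) + 1 / 2) :=
    div_pos (by exact_mod_cast Nat.factorial_pos _) (ascPochhammer_pos _ _ hb)
  have hB : 0 < (d ! : ℝ) / (ascPochhammer ℝ d).eval ((n : ℝ) + 1 / 2) :=
    div_pos (by exact_mod_cast Nat.factorial_pos _) (ascPochhammer_pos _ _ hb)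
  have hcm : 0 < (((n : ℝ) + 1 / 2) * skelKappa γ n) ^ m := pow_pos hc m
  have hUm : 0 < |e + skelTheta γ n| ^ m := pow_pos hU m
  -- Laguerre forms of `A^{d−m}` and `A^{d}` at `e`
  rw [eval_appellPoly_skeletonSeq_laguerre γ n (d - m) hne, eval_appellPoly_skeletonSeq_laguerre γ n d hne,
    abs_mul, abs_mul, abs_pow, abs_of_pos hA, abs_mul, abs_mul, abs_pow, abs_of_pos hB]
  -- abbreviations
  set Lm := |(laguerre ((n : ℝ) - 1 / 2) (d - m)).eval (-(((n : ℝ) + 1 / 2) * skelKappa γ n) / (e + skelTheta γ n))|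
    with hLm
  set L2 := |(laguerre ((n : ℝ) - 1 / 2) (d - 2)).eval (-(((n : ℝ) + 1 / 2) * skelKappa γ n) / (e + skelTheta γ n))|
    with hL2
  set Ld := |(laguerre ((n : ℝ) - 1 / 2) d).eval (-(((n : ℝ) + 1 / 2) * skelKappa γ n) / (e + skelTheta γ n))|
    with hLd'
  set A := (((d - m) ! : ℕ) : ℝ) / (ascPochhammer ℝ (d - m)).eval ((n : ℝ) + 1 / 2) with hA'
  set B := (d ! : ℝ) / (ascPochhammer ℝ d).eval ((n : ℝ) + 1 / 2) with hB'
  set C := (((n : ℝ) + 1 / 2) * skelKappa γ n) ^ m with hC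
  set U := |e + skelTheta γ n| with hU'
  -- step 1: clear `c^m/U^m`
  have h1 : A * Lm ≤ K * B * Ld * U ^ m := by
    have hmul := mul_le_mul_of_nonneg_right hLτ (div_pos hUm hcm).le
    have e1 : A * (C / U ^ m) * Lm * (U ^ m / C) = A * Lm := by
      field_simp
    have e2 : K * (C * B * (((n : ℝ) + 1 / 2 + d - 2) / d)) * L2 * (U ^ m / C) =
        K * B * ((((n : ℝ) + 1 / 2 + d - 2) / d) * L2) * U ^ m := by
      field_simp
    rw [e1, e2, ← hLd] at hmul
    exact hmul
  -- step 2: multiply by `U^{d−m}`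
  have hUdm : 0 ≤ U ^ (d - m) := pow_nonneg hU.le _
  calc U ^ (d - m) * A * Lm = U ^ (d - m) * (A * Lm) := by ring
    _ ≤ U ^ (d - m) * (K * B * Ld * U ^ m) := mul_le_mul_of_nonneg_left h1 hUdm
    _ = K * (U ^ d * B * Ld) := by
        rw [show U ^ d = U ^ (d - m) * U ^ m by rw [← pow_add, Nat.sub_add_cancel hm]]
        ring

end Summit.RiemannHypothesis.RiemannHypothesis.Theorems.JensenPolynomials

end
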